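import Literature.Computability.AlgebraicComplexity.GKKP11Lemma5Construction
import HarnessLib

/-!
# GKKP 2011, Lemma 5 (minimization): structure of the minimized circuit and the discharge

[cite: GrenetEtAl2011, Lemma 5] — B. Grenet, E. L. Kaltofen, P. Koiran, N. Portier, *Symmetric
determinantal representation of weakly-skew circuits*, Contemp. Math. 556 (2011) =
arXiv:1007.3804, §3.3 Lemma 5 with its proof and the remark following it (held text
`paper:arxiv-1007.3804`, p0014:L27–L49: the lemma, the four rewriting rules, and "Note that the
above lemma is valid for any kind of arithmetic circuit, and that the construction does not change
the nature of the circuit. So this can be applied to a formula to get a formula, or to a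
weakly-skew circuit to get a weakly-skew circuit.").

This file is the SECOND HALF of the discharge of the named fact `GKKP2011_lemma5`
(`GKKP11SymmetricRepresentations.lean`); the first half is the sibling
`GKKP11Lemma5Construction.lean` (the one-pass rewriting `GKKP2011.Lemma5.minimize` realising the
four printed rules, its value invariant `Inv`, and the consequences `wellFormed_minimize`,
`numVarInputs_minimize`, `skinnySize_minimize_le`, `eval_minimize`). Here:

* `GKKP2011.Lemma5.Shape` / `SInv` / `sinv_step` / `sinv_run` — the STRUCTURAL invariant of the
  pass: every emitted vertex is either the copy of a kept (= not variable-free) old gate, of one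
  of seven explicit shapes (a variable input; a computation gate with both arguments kept; a
  computation gate with one variable-free argument, re-emitted as the weighted addition gate
  consuming the fresh input `1` emitted just before it), or such a fresh input `1`, consumed
  exactly by the next vertex; the renumbering of kept gates is strictly increasing; a dropped
  gate is a constant input or a computation gate with both arguments dropped.
* Consequences = the three printed items and the two sentences around them:
  `isProper_minimize` ("exactly one vertex of out-degree `0`": arrows between kept gates are
  copied, Lemma 5's "equivalent circuit" is again a circuit), `isMinimized_minimize` (items
  (i)–(iii) of Lemma 5), and `isWeaklySkew_minimize` ("the construction does not change the
  nature of the circuit … a weakly-skew circuit to get a weakly-skew circuit": sub-circuits of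
  the minimized circuit are, vertex for vertex, the images of the sub-circuits of the original
  one restricted to kept gates, plus the fresh inputs hanging off them —
  `inSubCircuit_img_cases`, `inSubCircuit_of_inSubCircuit` — so a closed multiplicand stays
  closed, `isClosedArg_transfer`).
* `GKKP2011_lemma5_holds : GKKP2011_lemma5` — the discharge, BY NAME.

Deviation from the printed proof (disclosed in the sibling file and repeated here): the printed
rules 3/4 delete a multiplication gate with a constant argument and re-route / re-scale arrows;
the pass instead re-emits it as the addition gate `(c₁ v c₂)·γ + 0·1` (same polynomial, one more
constant input of out-degree `1`, no multiplication gate left with a constant argument, at most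
the same number of computation gates — all that Lemma 5 (i)–(iii) and Def. 7 ask). The typed
fact carries the printed proof's standing assumption "there exists some input gate labelled by a
variable, otherwise the polynomial computed by `C` would be constant" as the hypothesis that the
computed polynomial is not a constant; it is used exactly once, to know that the output gate is
kept.

No named facts, no `sorry`; definitions with bodies (two bookkeeping predicates) and theorems
only (D-0026). Honest framing: this discharges a normal-form lemma of the literature used by rung
V1 of the `ValiantsHypothesis` ladder (`GKKP2011_thm6` is stated over minimized circuits);
`VP ≠ VNP` is NOT proved and nothing here is progress on it.
-/

namespace Literature.Computability.AlgebraicComplexity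

namespace GKKP2011

namespace Lemma5

/-! ## Generic helpers on gate lists -/

section Helpers

variable {k : Type*} {σ : Type*}

/-- A listed entry survives appending. [folklore] -/
private theorem gso {α : Type*} {l : List α} (r : List α) {n : ℕ} {a : α} (h : l[n]? = some a) :
    (l ++ r)[n]? = some a := by
  rw [List.getElem?_append_left ((List.getElem?_eq_some_iff.1 h).1)]
  exact h

/-- Reading an entry of `l ++ [x]`: an old entry or the new one. [folklore] -/
private theorem get_append_singleton {α : Type*} {l : List α} {x a : α} {p : ℕ}
    (h : (l ++ [x])[p]? = some a) : (p < l.length ∧ l[p]? = some a) ∨ (p = l.length ∧ x = a) := by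
  by_cases hp : p < l.length
  · left
    rw [List.getElem?_append_left hp] at h
    exact ⟨hp, h⟩
  · right
    obtain ⟨hlt, _⟩ := List.getElem?_eq_some_iff.1 h
    have hpe : p = l.length := by simp at hlt; omega
    subst hpe
    simp at h
    exact ⟨rfl, h⟩

/-- Reading an entry of `l ++ r`: an old entry or an entry of `r`. [folklore] -/
private theorem get_append {α : Type*} {l r : List α} {a : α} {p : ℕ} (h : (l ++ r)[p]? = some a) :
    (p < l.length ∧ l[p]? = some a) ∨ (l.length ≤ p ∧ r[p - l.length]? = some a) := by
  by_cases hp : p < l.length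
  · left
    rw [List.getElem?_append_left hp] at h
    exact ⟨hp, h⟩
  · right
    rw [List.getElem?_append_right (by omega)] at h
    exact ⟨by omega, h⟩

/-- The arguments of a listed gate. [cite: GrenetEtAl2011, Def 1] -/
private theorem argsAt_eq_args (C : Circuit k σ) {p : ℕ} {g : Node k σ}
    (hg : C.gates[p]? = some g) : C.argsAt p = g.args := by
  unfold Circuit.argsAt
  rw [hg]

/-- Membership in `argsAt`. [cite: GrenetEtAl2011, Def 1] -/
private theorem mem_argsAt_iff (C : Circuit k σ) {q p : ℕ} :
    q ∈ C.argsAt p ↔ ∃ g, C.gates[p]? = some g ∧ q ∈ g.args := by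
  unfold Circuit.argsAt
  cases hg : C.gates[p]? with
  | none => simp
  | some g => simp

/-- A gate with arguments is a listed gate. [cite: GrenetEtAl2011, Def 1] -/
private theorem lt_length_of_mem_argsAt (C : Circuit k σ) {q p : ℕ} (h : q ∈ C.argsAt p) :
    p < C.gates.length := by
  obtain ⟨g, hg, -⟩ := (mem_argsAt_iff C).1 h
  exact (List.getElem?_eq_some_iff.1 hg).1

/-- In a well-formed circuit arguments come earlier. [cite: GrenetEtAl2011, Def 1] -/
private theorem lt_of_mem_argsAt (C : Circuit k σ) (hwf : C.WellFormed) {q p : ℕ}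
    (h : q ∈ C.argsAt p) : q < p := by
  obtain ⟨g, hg, hq⟩ := (mem_argsAt_iff C).1 h
  exact hwf p g hg q hq

/-- Sub-circuits only contain earlier gates. [cite: GrenetEtAl2011, Def 2] -/
private theorem le_of_inSubCircuit (C : Circuit k σ) (hwf : C.WellFormed) {q p : ℕ}
    (h : C.InSubCircuit q p) : q ≤ p := by
  induction h with
  | refl => exact le_rfl
  | tail _ hrp ih => exact ih.trans (lt_of_mem_argsAt C hwf hrp).le

/-- `argsAt` of an extended gate list at an old index. [folklore] -/
private theorem argsAt_append_left (l r : List (Node k σ)) {p : ℕ} (hp : p < l.length) :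
    (⟨l ++ r⟩ : Circuit k σ).argsAt p = (⟨l⟩ : Circuit k σ).argsAt p := by
  unfold Circuit.argsAt
  simp only [List.getElem?_append_left hp]

/-- Sub-circuit membership survives extending the gate list. [folklore] -/
private theorem inSubCircuit_append_left (l r : List (Node k σ)) {q p : ℕ}
    (h : (⟨l⟩ : Circuit k σ).InSubCircuit q p) : (⟨l ++ r⟩ : Circuit k σ).InSubCircuit q p := by
  induction h with
  | refl => exact Relation.ReflTransGen.refl
  | tail _ hbc ih =>
    refine ih.tail ?_
    change _ ∈ Circuit.argsAt _ _
    rw [argsAt_append_left l r (lt_length_of_mem_argsAt _ hbc)]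
    exact hbc

/-- The fresh constant emitted before a gate `g'` is an argument of `g'`. [folklore] -/
private theorem mem_argsAt_fresh [One k] (out : List (Node k σ)) (g' : Node k σ)
    (hm : out.length ∈ g'.args) :
    out.length ∈ (⟨out ++ [Node.const 1, g']⟩ : Circuit k σ).argsAt (out.length + 1) := by
  have h : (out ++ [Node.const 1, g'])[out.length + 1]? = some g' := by simp
  rw [argsAt_eq_args ⟨out ++ [Node.const 1, g']⟩ h]
  exact hm

/-- Out-degree of the head-extended list. [cite: GrenetEtAl2011, Def 1] -/
private theorem outDegree_cons (g : Node k σ) (l : List (Node k σ)) (n : ℕ) :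
    (⟨g :: l⟩ : Circuit k σ).outDegree n = g.args.count n + (⟨l⟩ : Circuit k σ).outDegree n := by
  simp [Circuit.outDegree]

/-- The out-degree as a sum over the vertices. [cite: GrenetEtAl2011, Def 1] -/
private theorem outDegree_eq_sum (l : List (Node k σ)) (n : ℕ) :
    (⟨l⟩ : Circuit k σ).outDegree n = ∑ i : Fin l.length, (l[(i : ℕ)]).args.count n := by
  unfold Circuit.outDegree
  have h : l.map (fun g => g.args.count n) =
      List.ofFn (fun i : Fin l.length => (l[(i : ℕ)]).args.count n) := by
    apply List.ext_getElem <;> simp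
  rw [h, List.sum_ofFn]

/-- An arrow `n → d` contributes to the out-degree of `n`. [cite: GrenetEtAl2011, Def 1] -/
private theorem outDegree_pos_of_mem_argsAt (C : Circuit k σ) {n d : ℕ} (h : n ∈ C.argsAt d) :
    0 < C.outDegree n := by
  obtain ⟨g, hg, hn⟩ := (mem_argsAt_iff C).1 h
  obtain ⟨hd, hgd⟩ := List.getElem?_eq_some_iff.1 hg
  obtain ⟨gates⟩ := C
  change (⟨gates⟩ : Circuit k σ).gates[d]? = some g at hg
  rw [outDegree_eq_sum]
  have h1 : 0 < (gates[d]).args.count n := by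
    rw [show gates[d] = g from hgd]
    exact List.count_pos_iff.2 hn
  exact h1.trans_le (Finset.single_le_sum (f := fun i : Fin gates.length => (gates[(i : ℕ)]).args.count n)
    (fun i _ => Nat.zero_le _) (Finset.mem_univ ⟨d, hd⟩))

/-- A vertex of positive out-degree has an outgoing arrow. [cite: GrenetEtAl2011, Def 1] -/
private theorem exists_mem_argsAt_of_outDegree_pos (C : Circuit k σ) {n : ℕ}
    (h : 0 < C.outDegree n) : ∃ d, n ∈ C.argsAt d := by
  by_contra hcon
  have hcon' : ∀ d, n ∉ C.argsAt d := fun d hd => hcon ⟨d, hd⟩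
  obtain ⟨gates⟩ := C
  rw [outDegree_eq_sum] at h
  refine absurd (Finset.sum_eq_zero fun i _ => ?_) h.ne'
  have hi : (⟨gates⟩ : Circuit k σ).gates[(i : ℕ)]? = some (gates[(i : ℕ)]) :=
    List.getElem?_eq_getElem i.2
  have := hcon' i
  rw [argsAt_eq_args ⟨gates⟩ hi] at this
  exact List.count_eq_zero.2 this

/-- Counting in a two-element list. [folklore] -/
private theorem count_pair (e a b : ℕ) :
    List.count e [a, b] = (if a = e then 1 else 0) + (if b = e then 1 else 0) := by
  rw [List.count_cons, List.count_cons, List.count_nil]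
  by_cases ha : a = e <;> by_cases hb : b = e <;> simp [ha, hb]

/-- Reading the map `ρ`: `getD i none = some i'` means gate `i` was kept as `i'`. [folklore] -/
private theorem rho_some {s : State k σ} {i i' : ℕ} (h : s.ρ.getD i none = some i') :
    s.ρ[i]? = some (some i') := by
  rw [List.getD_eq_getElem?_getD] at h
  cases hρ : s.ρ[i]? with
  | none => rw [hρ] at h; cases h
  | some x => rw [hρ] at h; simp only [Option.getD_some] at h; rw [h]

/-- Reading the map `ρ`: `getD i none = none` at a processed index means gate `i` was dropped.
[folklore] -/
private theorem rho_none {s : State k σ} {i : ℕ} (h : s.ρ.getD i none = none)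
    (hi : i < s.ρ.length) : s.ρ[i]? = some none := by
  rw [List.getD_eq_getElem?_getD, List.getElem?_eq_getElem hi, Option.getD_some] at h
  rw [List.getElem?_eq_getElem hi, h]

end Helpers

/-! ## The structural invariant of the pass -/

section Structure

variable {k : Type*} [Field k] {σ : Type*}

/-- New index `n` is the emitted copy of a kept old gate (`ρ p = n` for some old `p`).
[cite: GrenetEtAl2011, Lemma 5 (proof)] -/
def IsImg (s : State k σ) (n : ℕ) : Prop := ∃ p : ℕ, s.ρ[p]? = some (some n)

/-- The shape of the emitted copy `p'` of a kept old gate `g` (seven cases: a variable input; an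
addition / multiplication gate with both arguments kept, copied with translated arguments; an
addition / multiplication gate with exactly one variable-free argument, re-emitted as a weighted
addition gate consuming the fresh input `1` at `p' - 1` — printed rule 1 "`β` is replaced by `1`
and `c` by `cc₁`", and our form of rules 3/4). Constant inputs are never kept (rule 1/2).
[cite: GrenetEtAl2011, Lemma 5 (proof)] -/
def Shape (s : State k σ) : Node k σ → ℕ → Prop
  | .var x, p' => s.out[p']? = some (.var x)
  | .const _, _ => False
  | .add c₁ i c₂ j, p' =>
      (∃ a b : ℕ, s.ρ[i]? = some (some a) ∧ s.ρ[j]? = some (some b) ∧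
          s.out[p']? = some (.add c₁ a c₂ b)) ∨
      (∃ (w : k) (n b : ℕ), s.ρ[i]? = some none ∧ s.ρ[j]? = some (some b) ∧ p' = n + 1 ∧
          s.out[n]? = some (.const 1) ∧ s.out[p']? = some (.add w n c₂ b)) ∨
      (∃ (w : k) (n a : ℕ), s.ρ[i]? = some (some a) ∧ s.ρ[j]? = some none ∧ p' = n + 1 ∧
          s.out[n]? = some (.const 1) ∧ s.out[p']? = some (.add c₁ a w n))
  | .mul c₁ i c₂ j, p' =>
      (∃ a b : ℕ, s.ρ[i]? = some (some a) ∧ s.ρ[j]? = some (some b) ∧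
          s.out[p']? = some (.mul c₁ a c₂ b)) ∨
      (∃ (w : k) (n b : ℕ), s.ρ[i]? = some none ∧ s.ρ[j]? = some (some b) ∧ p' = n + 1 ∧
          s.out[n]? = some (.const 1) ∧ s.out[p']? = some (.add w b 0 n)) ∨
      (∃ (w : k) (n a : ℕ), s.ρ[i]? = some (some a) ∧ s.ρ[j]? = some none ∧ p' = n + 1 ∧
          s.out[n]? = some (.const 1) ∧ s.out[p']? = some (.add w a 0 n))

/-- **Structural invariant of the pass** after a prefix `gs`: the renumbering of kept gates is
strictly increasing; every kept gate has one of the seven shapes; a dropped gate is a constant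
input or a computation gate with both arguments dropped; every emitted constant input is the
fresh `1` consumed by the next vertex, which is a kept copy; every emitted vertex is a kept copy
or a constant input. [cite: GrenetEtAl2011, Lemma 5 (proof)] -/
structure SInv (gs : List (Node k σ)) (s : State k σ) : Prop where
  mono : ∀ p₁ p₂ a b : ℕ, p₁ < p₂ → s.ρ[p₁]? = some (some a) → s.ρ[p₂]? = some (some b) → a < b
  shape : ∀ p p' : ℕ, s.ρ[p]? = some (some p') → ∃ g, gs[p]? = some g ∧ Shape s g p'
  dropped : ∀ p : ℕ, s.ρ[p]? = some none →
    (∃ c, gs[p]? = some (.const c)) ∨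
    (∃ g, gs[p]? = some g ∧ g.isComputation = true ∧ ∀ i ∈ g.args, s.ρ[i]? = some none)
  fresh : ∀ (n : ℕ) (c : k), s.out[n]? = some (.const c) →
    c = 1 ∧ IsImg s (n + 1) ∧ n ∈ (⟨s.out⟩ : Circuit k σ).argsAt (n + 1)
  cover : ∀ n : ℕ, n < s.out.length → IsImg s n ∨ ∃ c, s.out[n]? = some (.const c)

/-- The structural invariant holds for the empty prefix. [folklore] -/
private theorem sinv_nil : SInv (k := k) (σ := σ) [] ⟨[], [], []⟩ :=
  ⟨fun _ _ _ _ _ h => by simp at h, fun _ _ h => by simp at h, fun _ h => by simp at h,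
    fun _ _ h => by simp at h, fun _ h => by simp at h⟩

/-- The value invariant holds for the empty prefix (as in the sibling file, where it is private).
[folklore] -/
private theorem inv_nil' : Inv (k := k) (σ := σ) [] ⟨[], [], []⟩ :=
  ⟨rfl, rfl, fun q g h => by simp at h, fun p p' h => by simp at h, fun p h => by simp at h,
    fun p' h => by simp at h, rfl, le_rfl⟩

/-- Shapes survive extending the state. [folklore] -/
private theorem Shape.mono {s : State k σ} {g : Node k σ} {p' : ℕ} (h : Shape s g p')
    (extra : List (Node k σ)) (x : Option ℕ) (v : k) :
    Shape ⟨s.out ++ extra, s.ρ ++ [x], s.val ++ [v]⟩ g p' := by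
  cases g with
  | var y =>
    simp only [Shape] at h ⊢
    exact gso extra h
  | const c => exact h.elim
  | add c₁ i c₂ j =>
    simp only [Shape] at h ⊢
    rcases h with ⟨a, b, h1, h2, h3⟩ | ⟨w, n, b, h1, h2, h3, h4, h5⟩ | ⟨w, n, a, h1, h2, h3, h4, h5⟩
    · exact Or.inl ⟨a, b, gso [x] h1, gso [x] h2, gso extra h3⟩
    · exact Or.inr (Or.inl ⟨w, n, b, gso [x] h1, gso [x] h2, h3, gso extra h4, gso extra h5⟩)
    · exact Or.inr (Or.inr ⟨w, n, a, gso [x] h1, gso [x] h2, h3, gso extra h4, gso extra h5⟩)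
  | mul c₁ i c₂ j =>
    simp only [Shape] at h ⊢
    rcases h with ⟨a, b, h1, h2, h3⟩ | ⟨w, n, b, h1, h2, h3, h4, h5⟩ | ⟨w, n, a, h1, h2, h3, h4, h5⟩
    · exact Or.inl ⟨a, b, gso [x] h1, gso [x] h2, gso extra h3⟩
    · exact Or.inr (Or.inl ⟨w, n, b, gso [x] h1, gso [x] h2, h3, gso extra h4, gso extra h5⟩)
    · exact Or.inr (Or.inr ⟨w, n, a, gso [x] h1, gso [x] h2, h3, gso extra h4, gso extra h5⟩)

/-- Extending the structural invariant by one old gate `g` (`extra` new vertices emitted, `g`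
mapped to `x`): the generic bookkeeping, fed by the ten cases of `sinv_step`.
[cite: GrenetEtAl2011, Lemma 5 (proof)] -/
private theorem sinv_extend {gs : List (Node k σ)} {s : State k σ} (hI : Inv gs s) (h : SInv gs s)
    (g : Node k σ) (extra : List (Node k σ)) (x : Option ℕ) (v : k)
    (E1 : ∀ p', x = some p' → s.out.length ≤ p')
    (E2 : ∀ p', x = some p' → Shape ⟨s.out ++ extra, s.ρ ++ [x], s.val ++ [v]⟩ g p')
    (E3 : x = none → (∃ c, g = .const c) ∨
      (g.isComputation = true ∧ ∀ i ∈ g.args, s.ρ[i]? = some none))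
    (E4 : ∀ (n : ℕ) (c : k), extra[n]? = some (.const c) →
      c = 1 ∧ x = some (s.out.length + n + 1) ∧
        s.out.length + n ∈ (⟨s.out ++ extra⟩ : Circuit k σ).argsAt (s.out.length + n + 1))
    (E5 : ∀ n : ℕ, n < extra.length →
      x = some (s.out.length + n) ∨ ∃ c, extra[n]? = some (.const c)) :
    SInv (gs ++ [g]) ⟨s.out ++ extra, s.ρ ++ [x], s.val ++ [v]⟩ where
  mono := by
    intro p₁ p₂ a b hlt h1 h2
    rcases get_append_singleton h2 with ⟨hp₂, h2⟩ | ⟨hp₂, h2⟩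
    · rw [List.getElem?_append_left (hlt.trans hp₂)] at h1
      exact h.mono p₁ p₂ a b hlt h1 h2
    · rw [List.getElem?_append_left (by omega)] at h1
      exact (hI.kept p₁ a h1).1.trans_le (E1 b h2)
  shape := by
    intro p p' hp
    rcases get_append_singleton hp with ⟨-, hp⟩ | ⟨hpe, hx⟩
    · obtain ⟨g₀, hg₀, hsh⟩ := h.shape p p' hp
      exact ⟨g₀, gso [g] hg₀, hsh.mono extra x v⟩
    · refine ⟨g, ?_, E2 p' hx⟩
      rw [hpe, hI.len_ρ]
      simp
  dropped := by
    intro p hp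
    rcases get_append_singleton hp with ⟨-, hp⟩ | ⟨hpe, hx⟩
    · rcases h.dropped p hp with ⟨c, hc⟩ | ⟨g₀, hg₀, hcomp, hargs⟩
      · exact Or.inl ⟨c, gso [g] hc⟩
      · exact Or.inr ⟨g₀, gso [g] hg₀, hcomp, fun i hi => gso [x] (hargs i hi)⟩
    · rcases E3 hx with ⟨c, rfl⟩ | ⟨hcomp, hargs⟩
      · refine Or.inl ⟨c, ?_⟩
        rw [hpe, hI.len_ρ]
        simp
      · refine Or.inr ⟨g, ?_, hcomp, fun i hi => gso [x] (hargs i hi)⟩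
        rw [hpe, hI.len_ρ]
        simp
  fresh := by
    intro n c hn
    rcases get_append hn with ⟨-, hn⟩ | ⟨hge, hn⟩
    · obtain ⟨hc, ⟨p, hp⟩, hmem⟩ := h.fresh n c hn
      have hn1 : n + 1 < s.out.length := (hI.kept p (n + 1) hp).1
      refine ⟨hc, ⟨p, gso [x] hp⟩, ?_⟩
      change n ∈ (⟨s.out ++ extra⟩ : Circuit k σ).argsAt (n + 1)
      rw [argsAt_append_left s.out extra hn1]
      exact hmem
    · obtain ⟨hc, hx, hmem⟩ := E4 (n - s.out.length) c hn
      have h1 : s.out.length + (n - s.out.length) = n := by omega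
      rw [h1] at hx hmem
      refine ⟨hc, ⟨gs.length, ?_⟩, hmem⟩
      rw [← hI.len_ρ]
      simp [hx]
  cover := by
    intro n hn
    simp only [List.length_append] at hn
    by_cases hnl : n < s.out.length
    · rcases h.cover n hnl with ⟨p, hp⟩ | ⟨c, hc⟩
      · exact Or.inl ⟨p, gso [x] hp⟩
      · exact Or.inr ⟨c, gso extra hc⟩
    · rcases E5 (n - s.out.length) (by omega) with hx | ⟨c, hc⟩
      · have h1 : s.out.length + (n - s.out.length) = n := by omega
        rw [h1] at hx
        refine Or.inl ⟨gs.length, ?_⟩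
        rw [← hI.len_ρ]
        simp [hx]
      · refine Or.inr ⟨c, ?_⟩
        change (s.out ++ extra)[n]? = some (Node.const c)
        rw [List.getElem?_append_right (by omega)]
        exact hc

/-- **One step preserves the structural invariant** (the ten cases of the pass).
[cite: GrenetEtAl2011, Lemma 5 (proof)] -/
private theorem sinv_step {gs : List (Node k σ)} {s : State k σ} (hI : Inv gs s) (h : SInv gs s)
    (g : Node k σ) (hg : ∀ i ∈ g.args, i < gs.length) : SInv (gs ++ [g]) (step s g) := by
  have hlen := hI.len_ρ
  cases g with
  | var y =>
    simp only [step]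
    exact sinv_extend hI h (.var y) [.var y] (some s.out.length) 0
      (fun p' hp' => by cases hp'; exact le_rfl)
      (fun p' hp' => by cases hp'; simp [Shape])
      (fun hx => by cases hx)
      (fun n c hn => by rcases n with _ | n <;> simp at hn)
      (fun n hn => Or.inl (by simp at hn; subst hn; simp))
  | const c =>
    have := sinv_extend hI h (.const c) [] none c (fun p' hp' => by cases hp')
      (fun p' hp' => by cases hp') (fun _ => Or.inl ⟨c, rfl⟩) (fun n c hn => by simp at hn)
      (fun n hn => by simp at hn)
    simpa [step] using this
  | add c₁ i c₂ j =>
    have hi : i < s.ρ.length := by rw [hlen]; exact hg i (by simp [Node.args])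
    have hj : j < s.ρ.length := by rw [hlen]; exact hg j (by simp [Node.args])
    rcases hρi : s.ρ.getD i none with _ | i' <;> rcases hρj : s.ρ.getD j none with _ | j' <;>
      simp only [step, hρi, hρj]
    · -- both arguments dropped: the gate is variable-free and dropped
      have := sinv_extend hI h (.add c₁ i c₂ j) [] none
        (c₁ * s.val.getD i 0 + c₂ * s.val.getD j 0)
        (fun p' hp' => by cases hp') (fun p' hp' => by cases hp')
        (fun _ => Or.inr ⟨rfl, fun m hm => by
          simp only [Node.args, List.mem_cons, List.not_mem_nil, or_false] at hm
          rcases hm with rfl | rfl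
          · exact rho_none hρi hi
          · exact rho_none hρj hj⟩)
        (fun n c hn => by simp at hn) (fun n hn => by simp at hn)
      simpa using this
    · -- `i` dropped, `j` kept as `j'`: fresh `1` then the weighted addition gate
      refine sinv_extend hI h _ _ (some (s.out.length + 1)) 0
        (fun p' hp' => by cases hp'; omega) (fun p' hp' => ?_) (fun hx => by cases hx)
        (fun n c hn => ?_) (fun n hn => ?_)
      · cases hp'
        simp only [Shape]
        exact Or.inr (Or.inl ⟨c₁ * s.val.getD i 0, s.out.length, j', gso _ (rho_none hρi hi),
          gso _ (rho_some hρj), rfl, by simp, by simp⟩)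
      · rcases n with _ | _ | n
        · simp only [List.getElem?_cons_zero, Option.some.injEq, Node.const.injEq] at hn
          subst hn
          exact ⟨rfl, by simp, by simpa using mem_argsAt_fresh s.out _ (by simp [Node.args])⟩
        · simp at hn
        · simp at hn
      · rcases n with _ | _ | n
        · exact Or.inr ⟨1, by simp⟩
        · exact Or.inl (by simp)
        · simp at hn
    · -- `i` kept as `i'`, `j` dropped
      refine sinv_extend hI h _ _ (some (s.out.length + 1)) 0
        (fun p' hp' => by cases hp'; omega) (fun p' hp' => ?_) (fun hx => by cases hx)
        (fun n c hn => ?_) (fun n hn => ?_)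
      · cases hp'
        simp only [Shape]
        exact Or.inr (Or.inr ⟨c₂ * s.val.getD j 0, s.out.length, i', gso _ (rho_some hρi),
          gso _ (rho_none hρj hj), rfl, by simp, by simp⟩)
      · rcases n with _ | _ | n
        · simp only [List.getElem?_cons_zero, Option.some.injEq, Node.const.injEq] at hn
          subst hn
          exact ⟨rfl, by simp, by simpa using mem_argsAt_fresh s.out _ (by simp [Node.args])⟩
        · simp at hn
        · simp at hn
      · rcases n with _ | _ | n
        · exact Or.inr ⟨1, by simp⟩
        · exact Or.inl (by simp)
        · simp at hn
    · -- both kept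
      refine sinv_extend hI h _ _ (some s.out.length) 0
        (fun p' hp' => by cases hp'; exact le_rfl) (fun p' hp' => ?_) (fun hx => by cases hx)
        (fun n c hn => by rcases n with _ | n <;> simp at hn)
        (fun n hn => Or.inl (by simp at hn; subst hn; simp))
      cases hp'
      simp only [Shape]
      exact Or.inl ⟨i', j', gso _ (rho_some hρi), gso _ (rho_some hρj), by simp⟩
  | mul c₁ i c₂ j =>
    have hi : i < s.ρ.length := by rw [hlen]; exact hg i (by simp [Node.args])
    have hj : j < s.ρ.length := by rw [hlen]; exact hg j (by simp [Node.args])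
    rcases hρi : s.ρ.getD i none with _ | i' <;> rcases hρj : s.ρ.getD j none with _ | j' <;>
      simp only [step, hρi, hρj]
    · have := sinv_extend hI h (.mul c₁ i c₂ j) [] none
        (c₁ * s.val.getD i 0 * (c₂ * s.val.getD j 0))
        (fun p' hp' => by cases hp') (fun p' hp' => by cases hp')
        (fun _ => Or.inr ⟨rfl, fun m hm => by
          simp only [Node.args, List.mem_cons, List.not_mem_nil, or_false] at hm
          rcases hm with rfl | rfl
          · exact rho_none hρi hi
          · exact rho_none hρj hj⟩)
        (fun n c hn => by simp at hn) (fun n hn => by simp at hn)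
      simpa using this
    · refine sinv_extend hI h _ _ (some (s.out.length + 1)) 0
        (fun p' hp' => by cases hp'; omega) (fun p' hp' => ?_) (fun hx => by cases hx)
        (fun n c hn => ?_) (fun n hn => ?_)
      · cases hp'
        simp only [Shape]
        exact Or.inr (Or.inl ⟨c₁ * s.val.getD i 0 * c₂, s.out.length, j', gso _ (rho_none hρi hi),
          gso _ (rho_some hρj), rfl, by simp, by simp⟩)
      · rcases n with _ | _ | n
        · simp only [List.getElem?_cons_zero, Option.some.injEq, Node.const.injEq] at hn
          subst hn
          exact ⟨rfl, by simp, by simpa using mem_argsAt_fresh s.out _ (by simp [Node.args])⟩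
        · simp at hn
        · simp at hn
      · rcases n with _ | _ | n
        · exact Or.inr ⟨1, by simp⟩
        · exact Or.inl (by simp)
        · simp at hn
    · refine sinv_extend hI h _ _ (some (s.out.length + 1)) 0
        (fun p' hp' => by cases hp'; omega) (fun p' hp' => ?_) (fun hx => by cases hx)
        (fun n c hn => ?_) (fun n hn => ?_)
      · cases hp'
        simp only [Shape]
        exact Or.inr (Or.inr ⟨c₁ * (c₂ * s.val.getD j 0), s.out.length, i', gso _ (rho_some hρi),
          gso _ (rho_none hρj hj), rfl, by simp, by simp⟩)
      · rcases n with _ | _ | n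
        · simp only [List.getElem?_cons_zero, Option.some.injEq, Node.const.injEq] at hn
          subst hn
          exact ⟨rfl, by simp, by simpa using mem_argsAt_fresh s.out _ (by simp [Node.args])⟩
        · simp at hn
        · simp at hn
      · rcases n with _ | _ | n
        · exact Or.inr ⟨1, by simp⟩
        · exact Or.inl (by simp)
        · simp at hn
    · refine sinv_extend hI h _ _ (some s.out.length) 0
        (fun p' hp' => by cases hp'; exact le_rfl) (fun p' hp' => ?_) (fun hx => by cases hx)
        (fun n c hn => by rcases n with _ | n <;> simp at hn)
        (fun n hn => Or.inl (by simp at hn; subst hn; simp))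
      cases hp'
      simp only [Shape]
      exact Or.inl ⟨i', j', gso _ (rho_some hρi), gso _ (rho_some hρj), by simp⟩

/-- **The pass on a well-formed circuit satisfies both invariants.**
[cite: GrenetEtAl2011, Lemma 5 (proof)] -/
theorem sinv_run (C : Circuit k σ) (hwf : C.WellFormed) :
    Inv C.gates (run C.gates) ∧ SInv C.gates (run C.gates) := by
  suffices h : ∀ n, Inv (C.gates.take n) (run (C.gates.take n)) ∧
      SInv (C.gates.take n) (run (C.gates.take n)) by
    simpa using h C.gates.length
  intro n
  induction n with
  | zero =>
    simp only [List.take_zero, run, List.foldl_nil]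
    exact ⟨inv_nil', sinv_nil⟩
  | succ n ih =>
    by_cases hn : n < C.gates.length
    · rw [List.take_add_one, List.getElem?_eq_getElem hn]
      simp only [Option.toList_some]
      rw [run_append_singleton]
      have hg : ∀ i ∈ (C.gates[n]).args, i < (C.gates.take n).length := fun i hi => by
        have := hwf n (C.gates[n]) (List.getElem?_eq_getElem hn) i hi
        rw [List.length_take]
        omega
      exact ⟨inv_step ih.1 _ hg, sinv_step ih.1 ih.2 _ hg⟩
    · have h1 : C.gates.take (n + 1) = C.gates := List.take_of_length_le (by omega)
      have h2 : C.gates.take n = C.gates := List.take_of_length_le (by omega)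
      rw [h1]
      rw [h2] at ih
      exact ih

end Structure

/-! ## Consequences for the minimized circuit -/

section Consequences

variable {k : Type*} [Field k] {σ : Type*} (C : Circuit k σ)

/-- The vertices of the minimized circuit are the emitted vertices. [cite: GrenetEtAl2011, Lemma 5] -/
private theorem minimize_gates : (minimize C).gates = (run C.gates).out := rfl

/-- Kept copies are vertices of the minimized circuit. [cite: GrenetEtAl2011, Lemma 5 (proof)] -/
private theorem img_lt (hwf : C.WellFormed) {p a : ℕ} (h : (run C.gates).ρ[p]? = some (some a)) :
    a < (minimize C).gates.length :=
  ((sinv_run C hwf).1.kept p a h).1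

/-- The renumbering of kept gates is injective. [cite: GrenetEtAl2011, Lemma 5 (proof)] -/
private theorem img_inj (hwf : C.WellFormed) {p₁ p₂ a : ℕ}
    (h1 : (run C.gates).ρ[p₁]? = some (some a)) (h2 : (run C.gates).ρ[p₂]? = some (some a)) :
    p₁ = p₂ := by
  rcases lt_trichotomy p₁ p₂ with hlt | heq | hgt
  · exact absurd ((sinv_run C hwf).2.mono _ _ _ _ hlt h1 h2) (lt_irrefl a)
  · exact heq
  · exact absurd ((sinv_run C hwf).2.mono _ _ _ _ hgt h2 h1) (lt_irrefl a)

/-- Kept copies are not constant inputs (rules 1/2: constants are never kept).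
[cite: GrenetEtAl2011, Lemma 5 (proof)] -/
private theorem not_const_of_img (hwf : C.WellFormed) {p a : ℕ}
    (h : (run C.gates).ρ[p]? = some (some a)) (c : k) :
    (minimize C).gates[a]? ≠ some (.const c) := by
  obtain ⟨g, -, hsh⟩ := (sinv_run C hwf).2.shape p a h
  intro hc
  rw [minimize_gates] at hc
  cases g with
  | var y =>
    simp only [Shape] at hsh
    rw [hsh] at hc
    simp at hc
  | const c' => exact hsh.elim
  | add c₁ i c₂ j =>
    simp only [Shape] at hsh
    rcases hsh with ⟨_, _, -, -, h3⟩ | ⟨_, _, _, -, -, -, -, h3⟩ | ⟨_, _, _, -, -, -, -, h3⟩ <;>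
      rw [h3] at hc <;> simp at hc
  | mul c₁ i c₂ j =>
    simp only [Shape] at hsh
    rcases hsh with ⟨_, _, -, -, h3⟩ | ⟨_, _, _, -, -, -, -, h3⟩ | ⟨_, _, _, -, -, -, -, h3⟩ <;>
      rw [h3] at hc <;> simp at hc

/-- **Arrows between kept gates are copied, with multiplicity** (the copy of `e₀` occurs among
the arguments of the copy of `p` exactly as often as `e₀` among those of `p`).
[cite: GrenetEtAl2011, Lemma 5 (proof)] -/
private theorem count_img (hwf : C.WellFormed) {p d e₀ e : ℕ}
    (hd : (run C.gates).ρ[p]? = some (some d)) (he : (run C.gates).ρ[e₀]? = some (some e)) :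
    ((minimize C).argsAt d).count e = (C.argsAt p).count e₀ := by
  obtain ⟨g, hg, hsh⟩ := (sinv_run C hwf).2.shape p d hd
  rw [argsAt_eq_args C hg]
  have key : ∀ q a : ℕ, (run C.gates).ρ[q]? = some (some a) → (a = e ↔ q = e₀) := by
    intro q a hq
    constructor
    · intro hae
      subst hae
      exact img_inj C hwf hq he
    · intro hqe
      subst hqe
      rw [hq] at he
      simpa using he
  have keyd : ∀ q : ℕ, (run C.gates).ρ[q]? = some none → (q = e₀ ↔ False) := by
    intro q hq
    refine ⟨fun hqe => ?_, False.elim⟩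
    subst hqe
    rw [hq] at he
    simp at he
  have keyc : ∀ n : ℕ, (run C.gates).out[n]? = some (.const 1) → (n = e ↔ False) := by
    intro n hn
    refine ⟨fun hne => ?_, False.elim⟩
    subst hne
    exact not_const_of_img C hwf he 1 hn
  cases g with
  | var y =>
    simp only [Shape] at hsh
    rw [argsAt_eq_args (minimize C) hsh]
    simp [Node.args]
  | const c => exact hsh.elim
  | add c₁ i c₂ j =>
    simp only [Shape] at hsh
    rcases hsh with ⟨a, b, h1, h2, h3⟩ | ⟨w, n, b, h1, h2, h3, h4, h5⟩ | ⟨w, n, a, h1, h2, h3, h4, h5⟩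
    · rw [argsAt_eq_args (minimize C) h3]
      simp only [Node.args, count_pair]
      simp [key i a h1, key j b h2]
    · rw [argsAt_eq_args (minimize C) h5]
      simp only [Node.args, count_pair]
      simp [keyc n h4, key j b h2, keyd i h1]
    · rw [argsAt_eq_args (minimize C) h5]
      simp only [Node.args, count_pair]
      simp [keyc n h4, key i a h1, keyd j h2]
  | mul c₁ i c₂ j =>
    simp only [Shape] at hsh
    rcases hsh with ⟨a, b, h1, h2, h3⟩ | ⟨w, n, b, h1, h2, h3, h4, h5⟩ | ⟨w, n, a, h1, h2, h3, h4, h5⟩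
    · rw [argsAt_eq_args (minimize C) h3]
      simp only [Node.args, count_pair]
      simp [key i a h1, key j b h2]
    · rw [argsAt_eq_args (minimize C) h5]
      simp only [Node.args, count_pair]
      simp [keyc n h4, key j b h2, keyd i h1]
    · rw [argsAt_eq_args (minimize C) h5]
      simp only [Node.args, count_pair]
      simp [keyc n h4, key i a h1, keyd j h2]

/-- **Every arrow of the minimized circuit** ends at a kept copy and starts at a kept copy or at
the fresh constant just below its end. [cite: GrenetEtAl2011, Lemma 5 (proof)] -/
private theorem args_cases (hwf : C.WellFormed) {a d : ℕ} (h : a ∈ (minimize C).argsAt d) :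
    IsImg (run C.gates) d ∧
      (IsImg (run C.gates) a ∨ (a + 1 = d ∧ (minimize C).gates[a]? = some (.const 1))) := by
  obtain ⟨-, hS⟩ := sinv_run C hwf
  have hd := lt_length_of_mem_argsAt _ h
  rcases hS.cover d hd with ⟨p, hp⟩ | ⟨c, hc⟩
  · refine ⟨⟨p, hp⟩, ?_⟩
    obtain ⟨g, -, hsh⟩ := hS.shape p d hp
    cases g with
    | var y =>
      simp only [Shape] at hsh
      rw [argsAt_eq_args (minimize C) hsh] at h
      simp [Node.args] at h
    | const c => exact hsh.elim
    | add c₁ i c₂ j =>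
      simp only [Shape] at hsh
      rcases hsh with ⟨a', b', h1, h2, h3⟩ | ⟨w, n, b', h1, h2, h3, h4, h5⟩ |
        ⟨w, n, a', h1, h2, h3, h4, h5⟩
      · rw [argsAt_eq_args (minimize C) h3] at h
        simp only [Node.args, List.mem_cons, List.not_mem_nil, or_false] at h
        rcases h with rfl | rfl
        · exact Or.inl ⟨i, h1⟩
        · exact Or.inl ⟨j, h2⟩
      · rw [argsAt_eq_args (minimize C) h5] at h
        simp only [Node.args, List.mem_cons, List.not_mem_nil, or_false] at h
        rcases h with rfl | rfl
        · exact Or.inr ⟨h3.symm, h4⟩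
        · exact Or.inl ⟨j, h2⟩
      · rw [argsAt_eq_args (minimize C) h5] at h
        simp only [Node.args, List.mem_cons, List.not_mem_nil, or_false] at h
        rcases h with rfl | rfl
        · exact Or.inl ⟨i, h1⟩
        · exact Or.inr ⟨h3.symm, h4⟩
    | mul c₁ i c₂ j =>
      simp only [Shape] at hsh
      rcases hsh with ⟨a', b', h1, h2, h3⟩ | ⟨w, n, b', h1, h2, h3, h4, h5⟩ |
        ⟨w, n, a', h1, h2, h3, h4, h5⟩
      · rw [argsAt_eq_args (minimize C) h3] at h
        simp only [Node.args, List.mem_cons, List.not_mem_nil, or_false] at h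
        rcases h with rfl | rfl
        · exact Or.inl ⟨i, h1⟩
        · exact Or.inl ⟨j, h2⟩
      · rw [argsAt_eq_args (minimize C) h5] at h
        simp only [Node.args, List.mem_cons, List.not_mem_nil, or_false] at h
        rcases h with rfl | rfl
        · exact Or.inl ⟨j, h2⟩
        · exact Or.inr ⟨h3.symm, h4⟩
      · rw [argsAt_eq_args (minimize C) h5] at h
        simp only [Node.args, List.mem_cons, List.not_mem_nil, or_false] at h
        rcases h with rfl | rfl
        · exact Or.inl ⟨i, h1⟩
        · exact Or.inr ⟨h3.symm, h4⟩
  · exfalso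
    rw [argsAt_eq_args (minimize C) hc] at h
    simp [Node.args] at h

/-- A fresh constant's only consumer is the next vertex. [cite: GrenetEtAl2011, Lemma 5 (i)] -/
private theorem eq_of_fresh_mem (hwf : C.WellFormed) {n d : ℕ} {c : k}
    (hn : (minimize C).gates[n]? = some (.const c)) (h : n ∈ (minimize C).argsAt d) :
    d = n + 1 := by
  rcases (args_cases C hwf h).2 with ⟨p, hp⟩ | ⟨h1, -⟩
  · exact absurd hn (not_const_of_img C hwf hp c)
  · exact h1.symm

/-- A fresh constant is consumed exactly once by the next vertex. [cite: GrenetEtAl2011, Lemma 5 (i)] -/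
private theorem count_fresh (hwf : C.WellFormed) {n : ℕ} {c : k}
    (hn : (minimize C).gates[n]? = some (.const c)) :
    ((minimize C).argsAt (n + 1)).count n = 1 := by
  obtain ⟨-, hS⟩ := sinv_run C hwf
  obtain ⟨-, ⟨p, hp⟩, hmem⟩ := hS.fresh n c hn
  change n ∈ (minimize C).argsAt (n + 1) at hmem
  obtain ⟨g, -, hsh⟩ := hS.shape p (n + 1) hp
  have hnot : ∀ q a : ℕ, (run C.gates).ρ[q]? = some (some a) → a ≠ n := fun q a hq han => by
    subst han
    exact not_const_of_img C hwf hq c hn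
  cases g with
  | var y =>
    simp only [Shape] at hsh
    rw [argsAt_eq_args (minimize C) hsh] at hmem
    simp [Node.args] at hmem
  | const c' => exact hsh.elim
  | add c₁ i c₂ j =>
    simp only [Shape] at hsh
    rcases hsh with ⟨a, b, h1, h2, h3⟩ | ⟨w, m, b, h1, h2, h3, h4, h5⟩ | ⟨w, m, a, h1, h2, h3, h4, h5⟩
    · rw [argsAt_eq_args (minimize C) h3] at hmem
      simp only [Node.args, List.mem_cons, List.not_mem_nil, or_false] at hmem
      rcases hmem with hmem | hmem
      · exact absurd hmem.symm (hnot i a h1)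
      · exact absurd hmem.symm (hnot j b h2)
    · have hm : m = n := by omega
      subst hm
      rw [argsAt_eq_args (minimize C) h5]
      simp [Node.args, hnot j b h2]
    · have hm : m = n := by omega
      subst hm
      rw [argsAt_eq_args (minimize C) h5]
      simp [Node.args, hnot i a h1]
  | mul c₁ i c₂ j =>
    simp only [Shape] at hsh
    rcases hsh with ⟨a, b, h1, h2, h3⟩ | ⟨w, m, b, h1, h2, h3, h4, h5⟩ | ⟨w, m, a, h1, h2, h3, h4, h5⟩
    · rw [argsAt_eq_args (minimize C) h3] at hmem
      simp only [Node.args, List.mem_cons, List.not_mem_nil, or_false] at hmem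
      rcases hmem with hmem | hmem
      · exact absurd hmem.symm (hnot i a h1)
      · exact absurd hmem.symm (hnot j b h2)
    · have hm : m = n := by omega
      subst hm
      rw [argsAt_eq_args (minimize C) h5]
      simp [Node.args, hnot j b h2]
    · have hm : m = n := by omega
      subst hm
      rw [argsAt_eq_args (minimize C) h5]
      simp [Node.args, hnot i a h1]

/-- **The consumer of a kept gate is kept** (a gate with a non-variable-free argument is not
variable-free). [cite: GrenetEtAl2011, Lemma 5 (proof)] -/
private theorem kept_of_arg_kept (hwf : C.WellFormed) {d₀ p a : ℕ} {g : Node k σ}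
    (hg : C.gates[d₀]? = some g) (hp : p ∈ g.args)
    (hpa : (run C.gates).ρ[p]? = some (some a)) :
    ∃ d, (run C.gates).ρ[d₀]? = some (some d) := by
  obtain ⟨hI, hS⟩ := sinv_run C hwf
  have hd₀ : d₀ < (run C.gates).ρ.length := by
    rw [hI.len_ρ]
    exact (List.getElem?_eq_some_iff.1 hg).1
  obtain ⟨y, hy⟩ : ∃ y, (run C.gates).ρ[d₀]? = some y := ⟨_, List.getElem?_eq_getElem hd₀⟩
  rcases y with _ | d
  · exfalso
    rcases hS.dropped d₀ hy with ⟨c, hc⟩ | ⟨g', hg', -, hargs⟩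
    · rw [hg] at hc
      simp only [Option.some.injEq] at hc
      subst hc
      simp [Node.args] at hp
    · rw [hg] at hg'
      simp only [Option.some.injEq] at hg'
      subst hg'
      have := hargs p hp
      rw [hpa] at this
      simp at this
  · exact ⟨d, hy⟩

/-- **Variable inputs are kept**, as variable inputs. [cite: GrenetEtAl2011, Lemma 5 (proof)] -/
private theorem kept_of_var (hwf : C.WellFormed) {p : ℕ} {y : σ}
    (hg : C.gates[p]? = some (.var y)) :
    ∃ a, (run C.gates).ρ[p]? = some (some a) ∧ (minimize C).gates[a]? = some (.var y) := by
  obtain ⟨hI, hS⟩ := sinv_run C hwf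
  have hp : p < (run C.gates).ρ.length := by
    rw [hI.len_ρ]
    exact (List.getElem?_eq_some_iff.1 hg).1
  obtain ⟨z, hz⟩ : ∃ z, (run C.gates).ρ[p]? = some z := ⟨_, List.getElem?_eq_getElem hp⟩
  rcases z with _ | a
  · exfalso
    rcases hS.dropped p hz with ⟨c, hc⟩ | ⟨g', hg', hcomp, -⟩
    · rw [hg] at hc
      simp at hc
    · rw [hg] at hg'
      simp only [Option.some.injEq] at hg'
      subst hg'
      simp [Node.isComputation] at hcomp
  · obtain ⟨g, hg', hsh⟩ := hS.shape p a hz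
    rw [hg] at hg'
    simp only [Option.some.injEq] at hg'
    subst hg'
    simp only [Shape] at hsh
    exact ⟨a, hz, hsh⟩

/-- **Below every kept copy there is a variable input** (kept = not variable-free, transported to
the minimized circuit). [cite: GrenetEtAl2011, Lemma 5 (proof)] -/
private theorem exists_var_below (hwf : C.WellFormed) (p : ℕ) :
    ∀ a : ℕ, (run C.gates).ρ[p]? = some (some a) →
      ∃ q, (minimize C).InSubCircuit q a ∧ (minimize C).IsVarInputAt q := by
  obtain ⟨-, hS⟩ := sinv_run C hwf
  refine Nat.strong_induction_on p ?_
  intro p ih a ha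
  obtain ⟨g, hg, hsh⟩ := hS.shape p a ha
  have use : ∀ i a₁ : ℕ, i ∈ g.args → (run C.gates).ρ[i]? = some (some a₁) →
      a₁ ∈ (minimize C).argsAt a →
      ∃ q, (minimize C).InSubCircuit q a ∧ (minimize C).IsVarInputAt q := by
    intro i a₁ hi hρ hmem
    obtain ⟨q, hq, hv⟩ := ih i (hwf p g hg i hi) a₁ hρ
    exact ⟨q, hq.tail hmem, hv⟩
  cases g with
  | var y =>
    simp only [Shape] at hsh
    exact ⟨a, Relation.ReflTransGen.refl, y, hsh⟩
  | const c => exact hsh.elim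
  | add c₁ i c₂ j =>
    simp only [Shape] at hsh
    rcases hsh with ⟨a', b', h1, h2, h3⟩ | ⟨w, n, b', h1, h2, h3, h4, h5⟩ |
      ⟨w, n, a', h1, h2, h3, h4, h5⟩
    · exact use i a' (by simp [Node.args]) h1
        (by rw [argsAt_eq_args (minimize C) h3]; simp [Node.args])
    · exact use j b' (by simp [Node.args]) h2
        (by rw [argsAt_eq_args (minimize C) h5]; simp [Node.args])
    · exact use i a' (by simp [Node.args]) h1
        (by rw [argsAt_eq_args (minimize C) h5]; simp [Node.args])
  | mul c₁ i c₂ j =>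
    simp only [Shape] at hsh
    rcases hsh with ⟨a', b', h1, h2, h3⟩ | ⟨w, n, b', h1, h2, h3, h4, h5⟩ |
      ⟨w, n, a', h1, h2, h3, h4, h5⟩
    · exact use i a' (by simp [Node.args]) h1
        (by rw [argsAt_eq_args (minimize C) h3]; simp [Node.args])
    · exact use j b' (by simp [Node.args]) h2
        (by rw [argsAt_eq_args (minimize C) h5]; simp [Node.args])
    · exact use i a' (by simp [Node.args]) h1
        (by rw [argsAt_eq_args (minimize C) h5]; simp [Node.args])

/-- **Multiplication gates of the minimized circuit** are the copies of the multiplication gates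
with both arguments kept, with both arguments kept copies (item (iii)).
[cite: GrenetEtAl2011, Lemma 5 (iii)] -/
private theorem of_mul (hwf : C.WellFormed) {d a b : ℕ} {c₁ c₂ : k}
    (h : (minimize C).gates[d]? = some (.mul c₁ a c₂ b)) :
    IsImg (run C.gates) a ∧ IsImg (run C.gates) b ∧
      ∃ (p i j : ℕ) (c₁' c₂' : k), (run C.gates).ρ[p]? = some (some d) ∧
        C.gates[p]? = some (.mul c₁' i c₂' j) ∧
        (run C.gates).ρ[i]? = some (some a) ∧ (run C.gates).ρ[j]? = some (some b) := by
  obtain ⟨-, hS⟩ := sinv_run C hwf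
  have hd := (List.getElem?_eq_some_iff.1 h).1
  rw [minimize_gates] at h
  rcases hS.cover d hd with ⟨p, hp⟩ | ⟨c, hc⟩
  · obtain ⟨g, hg, hsh⟩ := hS.shape p d hp
    cases g with
    | var y =>
      simp only [Shape] at hsh
      rw [h] at hsh
      simp at hsh
    | const c => exact hsh.elim
    | add c₁' i c₂' j =>
      simp only [Shape] at hsh
      rcases hsh with ⟨_, _, -, -, h3⟩ | ⟨_, _, _, -, -, -, -, h3⟩ | ⟨_, _, _, -, -, -, -, h3⟩ <;>
        rw [h] at h3 <;> simp at h3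
    | mul c₁' i c₂' j =>
      simp only [Shape] at hsh
      rcases hsh with ⟨a', b', h1, h2, h3⟩ | ⟨_, _, _, -, -, -, -, h3⟩ | ⟨_, _, _, -, -, -, -, h3⟩
      · rw [h] at h3
        simp only [Option.some.injEq, Node.mul.injEq] at h3
        obtain ⟨-, rfl, -, rfl⟩ := h3
        exact ⟨⟨i, h1⟩, ⟨j, h2⟩, p, i, j, c₁', c₂', hp, hg, h1, h2⟩
      · rw [h] at h3
        simp at h3
      · rw [h] at h3
        simp at h3
  · rw [h] at hc
    simp at hc

/-- **Addition gates of the minimized circuit**: each argument is a kept copy or a fresh constant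
input, and at least one is a kept copy (item (ii)). [cite: GrenetEtAl2011, Lemma 5 (ii)] -/
private theorem of_add (hwf : C.WellFormed) {d a b : ℕ} {c₁ c₂ : k}
    (h : (minimize C).gates[d]? = some (.add c₁ a c₂ b)) :
    (IsImg (run C.gates) a ∨ (minimize C).gates[a]? = some (.const 1)) ∧
    (IsImg (run C.gates) b ∨ (minimize C).gates[b]? = some (.const 1)) ∧
    (IsImg (run C.gates) a ∨ IsImg (run C.gates) b) := by
  obtain ⟨-, hS⟩ := sinv_run C hwf
  have hd := (List.getElem?_eq_some_iff.1 h).1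
  rw [minimize_gates] at h
  rcases hS.cover d hd with ⟨p, hp⟩ | ⟨c, hc⟩
  · obtain ⟨g, -, hsh⟩ := hS.shape p d hp
    cases g with
    | var y =>
      simp only [Shape] at hsh
      rw [h] at hsh
      simp at hsh
    | const c => exact hsh.elim
    | add c₁' i c₂' j =>
      simp only [Shape] at hsh
      rcases hsh with ⟨a', b', h1, h2, h3⟩ | ⟨w, n, b', h1, h2, h3, h4, h5⟩ |
        ⟨w, n, a', h1, h2, h3, h4, h5⟩
      · rw [h] at h3
        simp only [Option.some.injEq, Node.add.injEq] at h3
        obtain ⟨-, rfl, -, rfl⟩ := h3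
        exact ⟨Or.inl ⟨i, h1⟩, Or.inl ⟨j, h2⟩, Or.inl ⟨i, h1⟩⟩
      · rw [h] at h5
        simp only [Option.some.injEq, Node.add.injEq] at h5
        obtain ⟨-, rfl, -, rfl⟩ := h5
        exact ⟨Or.inr h4, Or.inl ⟨j, h2⟩, Or.inr ⟨j, h2⟩⟩
      · rw [h] at h5
        simp only [Option.some.injEq, Node.add.injEq] at h5
        obtain ⟨-, rfl, -, rfl⟩ := h5
        exact ⟨Or.inl ⟨i, h1⟩, Or.inr h4, Or.inl ⟨i, h1⟩⟩
    | mul c₁' i c₂' j =>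
      simp only [Shape] at hsh
      rcases hsh with ⟨a', b', h1, h2, h3⟩ | ⟨w, n, b', h1, h2, h3, h4, h5⟩ |
        ⟨w, n, a', h1, h2, h3, h4, h5⟩
      · rw [h] at h3
        simp at h3
      · rw [h] at h5
        simp only [Option.some.injEq, Node.add.injEq] at h5
        obtain ⟨-, rfl, -, rfl⟩ := h5
        exact ⟨Or.inl ⟨j, h2⟩, Or.inr h4, Or.inl ⟨j, h2⟩⟩
      · rw [h] at h5
        simp only [Option.some.injEq, Node.add.injEq] at h5
        obtain ⟨-, rfl, -, rfl⟩ := h5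
        exact ⟨Or.inl ⟨i, h1⟩, Or.inr h4, Or.inl ⟨i, h1⟩⟩
  · rw [h] at hc
    simp at hc

/-- **The minimized circuit is again a circuit**: nonempty, and every vertex other than the
output has an outgoing arrow (arrows between kept gates are copied, fresh constants feed the
next vertex, the output gate is kept). [cite: GrenetEtAl2011, Lemma 5] -/
theorem isProper_minimize (hC : C.IsArithCircuit) (hnc : ∀ c : k, C.eval ≠ MvPolynomial.C c) :
    (minimize C).IsProper := by
  obtain ⟨hwf, hne, hout⟩ := hC
  obtain ⟨hI, hS⟩ := sinv_run C hwf
  -- the output gate is kept (it computes a non-constant polynomial)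
  set m := C.gates.length with hm
  have hm0 : 0 < m := List.length_pos_of_ne_nil hne
  have hCeval : C.eval = (Circuit.gateValues C.gates).getD (m - 1) 0 := by
    rw [Circuit.eval, List.getLastD_eq_getLast?, List.getLast?_eq_getElem?,
      List.getD_eq_getElem?_getD, Circuit.length_gateValues]
  have hlen : (run C.gates).ρ.length = m := hI.len_ρ
  obtain ⟨x, hx⟩ : ∃ x, (run C.gates).ρ[m - 1]? = some x :=
    ⟨(run C.gates).ρ[m - 1]'(by omega), List.getElem?_eq_getElem _⟩
  rcases x with _ | p'
  · exact absurd (hCeval.trans (hI.dropped (m - 1) hx)) (hnc _)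
  have hlast : (run C.gates).ρ.getLast? = some (some p') := by
    rw [List.getLast?_eq_getElem?, hlen, hx]
  have hp1 := hI.lastKept p' hlast
  unfold Circuit.IsProper
  refine ⟨?_, fun n hn => ?_⟩
  · intro hnil
    rw [minimize_gates] at hnil
    rw [hnil] at hp1
    simp at hp1
  · change n + 1 < (run C.gates).out.length at hn
    rcases hS.cover n (by omega) with ⟨p, hp⟩ | ⟨c, hc⟩
    · -- `n` is the copy of the old gate `p`, which is not the output gate
      have hpm : p < m := by
        have := (List.getElem?_eq_some_iff.1 hp).1
        omega
      have hpne : p ≠ m - 1 := by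
        rintro rfl
        rw [hx] at hp
        simp only [Option.some.injEq] at hp
        subst hp
        omega
      obtain ⟨d₀, hd₀⟩ :=
        exists_mem_argsAt_of_outDegree_pos C (hout p (by change p + 1 < m; omega))
      obtain ⟨g₀, hg₀, hpg⟩ := (mem_argsAt_iff C).1 hd₀
      obtain ⟨d, hd⟩ := kept_of_arg_kept C hwf hg₀ hpg hp
      have hcount := count_img C hwf hd hp
      have hmem : n ∈ (minimize C).argsAt d :=
        List.count_pos_iff.1 (by rw [hcount]; exact List.count_pos_iff.2 hd₀)
      exact outDegree_pos_of_mem_argsAt _ hmem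
    · -- `n` is a fresh constant, consumed by the next vertex
      exact outDegree_pos_of_mem_argsAt _ (hS.fresh n c hc).2.2

/-- **The minimized circuit is minimized** (Lemma 5 (i)–(iii)). [cite: GrenetEtAl2011, Lemma 5] -/
theorem isMinimized_minimize (hwf : C.WellFormed) : (minimize C).IsMinimized := by
  obtain ⟨hI, hS⟩ := sinv_run C hwf
  have hvar : ∀ a, IsImg (run C.gates) a → ¬ (minimize C).IsVarFreeAt a := by
    rintro a ⟨p, hp⟩ hfree
    obtain ⟨q, hq, hv⟩ := exists_var_below C hwf p a hp
    exact hfree q hq hv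
  unfold Circuit.IsMinimized
  refine ⟨fun n c hn => ?_, fun d c₁ a c₂ b hd => ?_, fun d c₁ a c₂ b hd => ?_⟩
  · -- (i) constant inputs are `1` and have out-degree `1`
    obtain ⟨hc, ⟨p, hp⟩, -⟩ := hS.fresh n c hn
    refine ⟨hc, ?_⟩
    have hn1 : n + 1 < (run C.gates).out.length := (hI.kept p _ hp).1
    change (⟨(run C.gates).out⟩ : Circuit k σ).outDegree n = 1
    rw [outDegree_eq_sum, Finset.sum_eq_single ⟨n + 1, hn1⟩]
    · have hg : (minimize C).gates[n + 1]? = some ((run C.gates).out[n + 1]) :=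
        List.getElem?_eq_getElem hn1
      have := count_fresh C hwf hn
      rw [argsAt_eq_args (minimize C) hg] at this
      exact this
    · intro i _ hi
      apply List.count_eq_zero.2
      intro hmem
      have hg : (minimize C).gates[(i : ℕ)]? = some ((run C.gates).out[(i : ℕ)]) :=
        List.getElem?_eq_getElem i.2
      have hmem' : n ∈ (minimize C).argsAt i := by
        rw [argsAt_eq_args (minimize C) hg]
        exact hmem
      exact hi (Fin.ext (eq_of_fresh_mem C hwf hn hmem'))
    · intro h
      exact absurd (Finset.mem_univ _) h
  · -- (ii) addition gates
    obtain ⟨ha, hb, hab⟩ := of_add C hwf hd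
    refine ⟨?_, fun hfa => ?_, fun hfb => ?_⟩
    · rintro ⟨hfa, hfb⟩
      rcases hab with ha' | hb'
      · exact hvar a ha' hfa
      · exact hvar b hb' hfb
    · rcases ha with ha | ha
      · exact absurd hfa (hvar a ha)
      · exact ⟨1, ha⟩
    · rcases hb with hb | hb
      · exact absurd hfb (hvar b hb)
      · exact ⟨1, hb⟩
  · -- (iii) multiplication gates
    obtain ⟨ha, hb, -⟩ := of_mul C hwf hd
    exact ⟨hvar a ha, hvar b hb⟩

/-- **Sub-circuits of the minimized circuit**, seen from a kept copy `b` of `b₀`: a vertex below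
`b` is the copy of a kept gate below `b₀`, or a fresh constant whose consumer is one.
[cite: GrenetEtAl2011, Lemma 5 (proof)] -/
private theorem inSubCircuit_img_cases (hwf : C.WellFormed) {b₀ b : ℕ}
    (hb : (run C.gates).ρ[b₀]? = some (some b)) {e : ℕ} (he : (minimize C).InSubCircuit e b) :
    (∃ e₀, (run C.gates).ρ[e₀]? = some (some e) ∧ C.InSubCircuit e₀ b₀) ∨
    (∃ p₀, (minimize C).gates[e]? = some (.const 1) ∧
      (run C.gates).ρ[p₀]? = some (some (e + 1)) ∧ C.InSubCircuit p₀ b₀) := by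
  induction he using Relation.ReflTransGen.head_induction_on with
  | refl => exact Or.inl ⟨b₀, hb, Relation.ReflTransGen.refl⟩
  | @head e x hex _ ih =>
    obtain ⟨⟨x₀, hx₀⟩, hcases⟩ := args_cases C hwf hex
    have hx : C.InSubCircuit x₀ b₀ := by
      rcases ih with ⟨e₀, he₀, hsub⟩ | ⟨p₀, hconst, -, -⟩
      · rw [img_inj C hwf hx₀ he₀]
        exact hsub
      · exact absurd hconst (not_const_of_img C hwf hx₀ 1)
    rcases hcases with ⟨e₀, he₀⟩ | ⟨hex1, hconst⟩
    · refine Or.inl ⟨e₀, he₀, Relation.ReflTransGen.head ?_ hx⟩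
      have hcount := count_img C hwf hx₀ he₀
      exact List.count_pos_iff.1 (by rw [← hcount]; exact List.count_pos_iff.2 hex)
    · refine Or.inr ⟨x₀, hconst, ?_, hx⟩
      rw [hex1]
      exact hx₀

/-- **Sub-circuits of kept gates are copied**: a kept gate below the kept gate `b₀` has its copy
below the copy of `b₀`. [cite: GrenetEtAl2011, Lemma 5 (proof)] -/
private theorem inSubCircuit_of_inSubCircuit (hwf : C.WellFormed) {d₀ b₀ b : ℕ}
    (h : C.InSubCircuit d₀ b₀) (hb : (run C.gates).ρ[b₀]? = some (some b)) :
    ∀ d : ℕ, (run C.gates).ρ[d₀]? = some (some d) → (minimize C).InSubCircuit d b := by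
  induction h using Relation.ReflTransGen.head_induction_on with
  | refl =>
    intro d hd
    rw [hd] at hb
    simp only [Option.some.injEq] at hb
    subst hb
    exact Relation.ReflTransGen.refl
  | @head d₀ x₀ hdx _ ih =>
    intro d hd
    obtain ⟨g, hg, hmem⟩ := (mem_argsAt_iff C).1 hdx
    obtain ⟨x, hx⟩ := kept_of_arg_kept C hwf hg hmem hd
    refine Relation.ReflTransGen.head ?_ (ih x hx)
    have hcount := count_img C hwf hx hd
    exact List.count_pos_iff.1 (by rw [hcount]; exact List.count_pos_iff.2 hdx)

/-- **A closed multiplicand stays closed** ("the construction does not change the nature of the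
circuit"): if the sub-circuit of `b₀` is connected to the rest only by the arrow `b₀ → a₀`, then
the sub-circuit of the copy of `b₀` is connected to the rest only by the copy of that arrow.
[cite: GrenetEtAl2011, Lemma 5 (remark after the proof)] -/
private theorem isClosedArg_transfer (hwf : C.WellFormed) {a₀ b₀ a b : ℕ}
    (hcl : C.IsClosedArg a₀ b₀) (ha : (run C.gates).ρ[a₀]? = some (some a))
    (hb : (run C.gates).ρ[b₀]? = some (some b)) : (minimize C).IsClosedArg a b := by
  obtain ⟨-, hS⟩ := sinv_run C hwf
  intro d e hd he
  rcases inSubCircuit_img_cases C hwf hb he with ⟨e₀, he₀, hesub⟩ | ⟨p₀, hconst, hp₀, hpsub⟩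
  · -- `e` is the copy of `e₀`, a kept gate below `b₀`
    by_cases hdl : d < (minimize C).gates.length
    · rcases hS.cover d hdl with ⟨d₀, hd₀⟩ | ⟨c, hc⟩
      · -- `d` is the copy of `d₀`, which is not below `b₀`
        have hd₀sub : ¬ C.InSubCircuit d₀ b₀ := fun h =>
          hd (inSubCircuit_of_inSubCircuit C hwf h hb d hd₀)
        rw [count_img C hwf hd₀ he₀, hcl d₀ e₀ hd₀sub hesub]
        by_cases h1 : d₀ = a₀ ∧ e₀ = b₀
        · obtain ⟨rfl, rfl⟩ := h1
          rw [ha] at hd₀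
          rw [hb] at he₀
          simp only [Option.some.injEq] at hd₀ he₀
          subst hd₀
          subst he₀
          simp
        · rw [if_neg h1, if_neg]
          rintro ⟨rfl, rfl⟩
          exact h1 ⟨img_inj C hwf hd₀ ha, img_inj C hwf he₀ hb⟩
      · -- `d` is a fresh constant: no arguments, and not the copy `a`
        rw [argsAt_eq_args (minimize C) hc]
        simp only [Node.args, List.count_nil]
        rw [if_neg]
        rintro ⟨rfl, -⟩
        exact not_const_of_img C hwf ha c hc
    · -- `d` is not a vertex
      have hnone : (minimize C).gates[d]? = none := List.getElem?_eq_none (by omega)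
      unfold Circuit.argsAt
      rw [hnone]
      simp only [List.count_nil]
      rw [if_neg]
      rintro ⟨rfl, -⟩
      exact hdl (img_lt C hwf ha)
  · -- `e` is a fresh constant hanging off the copy of `p₀`, a kept gate below `b₀`
    have hne : ¬ (d = a ∧ e = b) := by
      rintro ⟨-, rfl⟩
      exact not_const_of_img C hwf hb 1 hconst
    rw [if_neg hne]
    apply List.count_eq_zero.2
    intro hmem
    have hde := eq_of_fresh_mem C hwf hconst hmem
    subst hde
    exact hd (inSubCircuit_of_inSubCircuit C hwf hpsub hb (e + 1) hp₀)

/-- **The minimized circuit of a weakly-skew circuit is weakly-skew** ("the construction does not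
change the nature of the circuit. So this can be applied … to a weakly-skew circuit to get a
weakly-skew circuit"). [cite: GrenetEtAl2011, Lemma 5 (remark after the proof)] -/
theorem isWeaklySkew_minimize (hws : C.IsWeaklySkew) (hnc : ∀ c : k, C.eval ≠ MvPolynomial.C c) :
    (minimize C).IsWeaklySkew := by
  obtain ⟨hC, hmul⟩ := hws
  have hwf : C.WellFormed := hC.1
  unfold Circuit.IsWeaklySkew
  refine ⟨⟨wellFormed_minimize C hwf, isProper_minimize C hC hnc⟩, ?_⟩
  intro a c₁ i c₂ j ha
  obtain ⟨-, -, p, i₀, j₀, c₁', c₂', hp, hg, hi, hj⟩ := of_mul C hwf ha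
  rcases hmul p c₁' i₀ c₂' j₀ hg with hcl | hcl
  · exact Or.inl (isClosedArg_transfer C hwf hcl hp hi)
  · exact Or.inr (isClosedArg_transfer C hwf hcl hp hj)

end Consequences

end Lemma5

end GKKP2011

/-! ## The discharge -/

/-- **GKKP 2011, Lemma 5 (minimization) — PROVED.** For every arithmetic circuit computing a
non-constant polynomial, the one-pass rewriting `GKKP2011.Lemma5.minimize` yields an equivalent
circuit with the same number of variable inputs and at most as many computation gates which is
minimized (Lemma 5 (i)–(iii)), and weakly-skew when the original is ("the construction does not
change the nature of the circuit"). [cite: GrenetEtAl2011, Lemma 5] -/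
theorem GKKP2011_lemma5_holds : GKKP2011_lemma5 := by
  intro k _ σ C hC hnc
  obtain ⟨hwf, hproper⟩ := hC
  exact ⟨GKKP2011.Lemma5.minimize C,
    ⟨GKKP2011.Lemma5.wellFormed_minimize C hwf,
      GKKP2011.Lemma5.isProper_minimize C ⟨hwf, hproper⟩ hnc⟩,
    GKKP2011.Lemma5.isMinimized_minimize C hwf,
    GKKP2011.Lemma5.eval_minimize C hwf hproper.1 hnc,
    GKKP2011.Lemma5.numVarInputs_minimize C hwf,
    GKKP2011.Lemma5.skinnySize_minimize_le C hwf,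
    fun hws => GKKP2011.Lemma5.isWeaklySkew_minimize C hws hnc⟩

end Literature.Computability.AlgebraicComplexity
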